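import Mathlib
import Summits.NavierStokesRegularity.NavierStokesRegularity.Theorems.EulerZoomLiouvillePowerGaugeEulerLiouvilleWeakCommutingMember
import Summits.NavierStokesRegularity.NavierStokesRegularity.Theorems.EulerZoomLiouvillePowerGaugeEulerLiouvilleSelfSimilarPressure
import Summits.NavierStokesRegularity.NavierStokesRegularity.Theorems.EulerZoomLiouvillePowerGaugeEulerLiouvilleEnergySaturationMember
import Summits.NavierStokesRegularity.NavierStokesRegularity.Theorems.EulerZoomLiouvillePowerGaugeEulerLiouvilleEnergySaturationShell
import Summits.NavierStokesRegularity.NavierStokesRegularity.Theorems.EulerZoomLiouvillePowerGaugeEulerLiouvilleSelfSimilarPastProfileEquations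
import HarnessLib

/-!
# Crux `EulerZoomLiouville.PowerGaugeEulerLiouville` (stmt-NavierStokesRegularity-19832), stub `stub_selfSimilarWeakRest`:
# FROM THE DISTRIBUTIONAL PROFILE EQUATION TO THE CURL-TESTED IDENTITY — weak members with Lamb-curl-free profile are trivial

Helper file (theorems only; `--supports stmt-NavierStokesRegularity-19832`; def-free).  Hand leafhand-ns-eulerzoomliouville-10 g1; closes the loop of
`…WeakCommutingVorticity` / `…WeakCommutingMember`: the «curl-tested weak profile identity without Lamb term» used there is DERIVED from the tree's
distributional profile equation `ProfileEquation.weak_profile_equation` under the natural weak hypothesis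

  `∫ ⟪V, (V·∇)η_ψ⟫ = 0` for all curl pairs `η_ψ = (∂ᵥψ) w − (∂_w ψ) v`

— the VELOCITY-TESTED WEAK CURL OF THE LAMB VECTOR vanishes (classically `∫⟪V,(V·∇)η⟫ = −∫⟪(curl V) × V, η⟫` for divergence-free test fields `η`,
and `η_ψ = −curl(ψ (v × w))`-type fields exhaust the curls; so this is `curl((curl V) × V) = 0` in `𝒟'`: weak generalized Beltrami / weakly commuting
velocity and vorticity).

* `WeakLamb.curlTested_of_lambFree` — profile level: `V, |V|², P ∈ L¹_loc`, the member's distributional Euler pair, exact self-similarity, and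
  the Lamb hypothesis ⇒ `γ(∫⟪V, Dη_ψ[y]⟫) + (4γ−1)(∫⟪V, η_ψ⟫) = 0` (`div η_ψ = 0`, so the pressure term drops);
* `Birth.selfSimilarWeak_of_lambFree` — BY NAME in the skeleton's binders, every `0 < ρ`, no `C²`: `InClass ρ u p H c → IsExactlySelfSimilar ρ u p V P →
  (∃ G, HasWeakGradient V G ∧ ‖G‖² ∈ L¹(B̄₁) ∧ Lamb hypothesis) → u = 0` a.e. (`|V|² ∈ L¹_loc` from the `A`-gauge, `P ∈ L¹_loc` from the `D`-gauge,
  then `…WeakCommutingMember`).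

WHAT THIS IS NOT: not a proof of the stub or the crux; nothing about Navier–Stokes. [folklore]
-/

noncomputable section

-- flat `Theorems/<Route><Decl>…` files of one crux share the namespace of the crux (tree convention)
set_option linter.dupNamespace false

open MeasureTheory Set Filter Topology Metric Function TopologicalSpace
open scoped RealInnerProductSpace NNReal ENNReal ContDiff

namespace Summit.NavierStokesRegularity.NavierStokesRegularity.Theorems.PowerGaugeEulerLiouville

open Literature.Analysis Literature.Analysis.FunctionSpaces Literature.Analysis.FluidPDE

namespace WeakLamb

variable {V : EuclideanSpace ℝ (Fin 3) → EuclideanSpace ℝ (Fin 3)} {P : EuclideanSpace ℝ (Fin 3) → ℝ}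

/-- `y ↦ Dη(y)[y]` is a test field for a test field `η`. [folklore] -/
theorem isTestFunctionOn_fderiv_apply_self {η : EuclideanSpace ℝ (Fin 3) → EuclideanSpace ℝ (Fin 3)}
    (hη : IsTestFunctionOn (⊤ : Opens (EuclideanSpace ℝ (Fin 3))) η) :
    IsTestFunctionOn (⊤ : Opens (EuclideanSpace ℝ (Fin 3))) (fun y : EuclideanSpace ℝ (Fin 3) => fderiv ℝ η y y) := by
  refine ⟨(hη.contDiff.fderiv_right (m := ∞) le_rfl).clm_apply contDiff_id, ?_, by simp⟩
  refine (hη.hasCompactSupport.fderiv (𝕜 := ℝ)).mono fun z hz => ?_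
  rw [mem_support] at hz ⊢
  contrapose! hz
  simp [hz]

/-- Integrability of the Lamb-type integrand `⟪V, Dη[V]⟫` for `|V|² ∈ L¹_loc` and a test field `η`. [folklore] -/
theorem integrable_inner_fderiv_apply (hV : LocallyIntegrable V volume) (hV2 : LocallyIntegrable (fun y => ‖V y‖ ^ 2) volume)
    {η : EuclideanSpace ℝ (Fin 3) → EuclideanSpace ℝ (Fin 3)} (hη : IsTestFunctionOn (⊤ : Opens (EuclideanSpace ℝ (Fin 3))) η) :
    Integrable (fun y => ⟪V y, fderiv ℝ η y (V y)⟫) volume := by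
  obtain ⟨K₀, K₁, K₂, -, hK₁, -⟩ := exists_bounds_of_isTestFunctionOn hη
  have hDηc : Continuous (fderiv ℝ η) := hη.contDiff.continuous_fderiv (by simp)
  set Kη : Set (EuclideanSpace ℝ (Fin 3)) := tsupport η with hKηdef
  have hKηc : IsCompact Kη := hη.hasCompactSupport
  have hDη0 : ∀ y, y ∉ Kη → fderiv ℝ η y = 0 := fun y hy => fderiv_of_notMem_tsupport ℝ hy
  have hVm : AEStronglyMeasurable V volume := hV.aestronglyMeasurable
  have hV2K : IntegrableOn (fun y => ‖V y‖ ^ 2) Kη volume := hV2.integrableOn_isCompact hKηc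
  refine ProfileEnergy.integrable_of_abs_le_on hKηc.measurableSet
    (hVm.inner (ProfileEnergy.aestronglyMeasurable_clm_apply hDηc.aestronglyMeasurable hVm)) hV2K (C := K₁)
    (fun y _ => ?_) (fun y hy => by rw [hDη0 y hy]; simp)
  rw [abs_pow, abs_norm]
  calc |⟪V y, fderiv ℝ η y (V y)⟫| ≤ ‖V y‖ * ‖fderiv ℝ η y (V y)‖ := abs_real_inner_le_norm _ _
    _ ≤ ‖V y‖ * (K₁ * ‖V y‖) := by
        refine mul_le_mul_of_nonneg_left ?_ (norm_nonneg _)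
        exact ((fderiv ℝ η y).le_opNorm _).trans (mul_le_mul_of_nonneg_right (hK₁ y) (norm_nonneg _))
    _ = K₁ * ‖V y‖ ^ 2 := by ring

/-- **FROM THE DISTRIBUTIONAL PROFILE EQUATION TO THE CURL-TESTED IDENTITY WITHOUT LAMB TERM.**  For an exactly self-similar distributional
Euler pair with `V, |V|², P ∈ L¹_loc` whose velocity-tested weak Lamb curl vanishes on the curl pairs `η_ψ = (∂ᵥψ)w − (∂_wψ)v`, the tree's
`ProfileEquation.weak_profile_equation` tested with `η_ψ` (divergence free, so no pressure term) is exactly the curl-tested identity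
`γ(∫⟪V, Dη_ψ[y]⟫) + (4γ−1)(∫⟪V, η_ψ⟫) = 0`. [folklore] -/
theorem curlTested_of_lambFree {γ : ℝ}
    {u : ℝ → EuclideanSpace ℝ (Fin 3) → EuclideanSpace ℝ (Fin 3)} {p : ℝ → EuclideanSpace ℝ (Fin 3) → ℝ}
    (hsol : IsDistributionalNSSolutionOn (slab (EuclideanSpace ℝ (Fin 3)) (Iio 0) isOpen_Iio) 0 0 u p)
    (hu : ∀ τ : ℝ, τ < 0 → u τ = selfSimilarCollapse γ 0 V τ)
    (hp : ∀ τ : ℝ, τ < 0 → p τ = selfSimilarCollapsePressure γ 0 P τ)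
    (hV : LocallyIntegrable V volume) (hV2 : LocallyIntegrable (fun y => ‖V y‖ ^ 2) volume)
    (hP : LocallyIntegrable P volume)
    (hLamb : ∀ ψ : EuclideanSpace ℝ (Fin 3) → ℝ, ContDiff ℝ ∞ ψ → HasCompactSupport ψ → ∀ v w : EuclideanSpace ℝ (Fin 3),
      ∫ y, ⟪V y, fderiv ℝ (fun z : EuclideanSpace ℝ (Fin 3) => fderiv ℝ ψ z v • w - fderiv ℝ ψ z w • v) y (V y)⟫ = 0) :
    ∀ ψ : EuclideanSpace ℝ (Fin 3) → ℝ, ContDiff ℝ ∞ ψ → HasCompactSupport ψ → ∀ v w : EuclideanSpace ℝ (Fin 3),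
      γ * (∫ y, ⟪V y, fderiv ℝ (fun z : EuclideanSpace ℝ (Fin 3) => fderiv ℝ ψ z v • w - fderiv ℝ ψ z w • v) y y⟫) +
        (4 * γ - 1) * (∫ y, ⟪V y, fderiv ℝ ψ y v • w - fderiv ℝ ψ y w • v⟫) = 0 := by
  intro ψ hψ hψs v w
  have hηT := isTestFunctionOn_fderiv_smul_sub hψ hψs v w
  have hdivη : ∀ y, VectorCalculus.divergence (fun z : EuclideanSpace ℝ (Fin 3) => fderiv ℝ ψ z v • w - fderiv ℝ ψ z w • v) y = 0 :=
    isDivFree_fderiv_smul_sub hψ v w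
  have H := ProfileEquation.weak_profile_equation hsol hu hp hV hV2 hP hηT
  simp only [hdivη, mul_zero, add_zero] at H
  -- integrability of the three surviving integrands
  have hI2 := integrable_inner_fderiv_apply hV hV2 hηT
  have hI1 : Integrable (fun y => ⟪V y, fderiv ℝ (fun z : EuclideanSpace ℝ (Fin 3) => fderiv ℝ ψ z v • w - fderiv ℝ ψ z w • v) y y⟫)
      volume := WeakCommuting.integrable_inner_test hV (isTestFunctionOn_fderiv_apply_self hηT)
  have hI0 : Integrable (fun y => ⟪V y, fderiv ℝ ψ y v • w - fderiv ℝ ψ y w • v⟫) volume :=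
    WeakCommuting.integrable_inner_test hV hηT
  have hC' : Integrable (fun y => γ *
      ⟪V y, fderiv ℝ (fun z : EuclideanSpace ℝ (Fin 3) => fderiv ℝ ψ z v • w - fderiv ℝ ψ z w • v) y y⟫) volume :=
    hI1.const_mul γ
  have hD' : Integrable (fun y => (4 * γ - 1) * ⟪V y, fderiv ℝ ψ y v • w - fderiv ℝ ψ y w • v⟫) volume :=
    hI0.const_mul _
  have hX : Integrable (fun y =>
      ⟪V y, fderiv ℝ (fun z : EuclideanSpace ℝ (Fin 3) => fderiv ℝ ψ z v • w - fderiv ℝ ψ z w • v) y (V y)⟫ +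
        γ * ⟪V y, fderiv ℝ (fun z : EuclideanSpace ℝ (Fin 3) => fderiv ℝ ψ z v • w - fderiv ℝ ψ z w • v) y y⟫) volume :=
    hI2.add hC'
  rw [integral_add hX hD', integral_add hI2 hC', integral_const_mul, integral_const_mul, hLamb ψ hψ hψs v w,
    zero_add] at H
  exact H

end WeakLamb

/-- **THE LAMB-CURL-FREE SUB-STRATUM OF THE WEAK SELF-SIMILAR RESIDUE IS CLOSED** (binder language of the skeleton of record, every `0 < ρ`, no `C²`
hypothesis).  A class member (`Birth.InClass`), exactly self-similar about the origin (`Birth.IsExactlySelfSimilar ρ u p V P`), whose velocity profile has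
a whole-space weak gradient `G` with `‖G‖²` integrable on the closed unit ball and whose velocity-tested weak Lamb curl vanishes on all curl pairs, is
trivial: `|V|² ∈ L¹_loc` (the `A`-gauge, `EnergySaturation.locallyIntegrable_norm_sq_of_growth`), `P ∈ L¹_loc` (the `D`-gauge,
`EnergySaturation.locallyIntegrable_pressure_of_weight`), `WeakLamb.curlTested_of_lambFree`, and `Loc.selfSimilar_ae_eq_zero_of_weaklyCommuting_profile`.
[folklore] -/
theorem Birth.selfSimilarWeak_of_lambFree :
    ∀ ρ : ℝ, 0 < ρ → ρ ≤ 1 / 2 →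
      ∀ (u : ℝ → EuclideanSpace ℝ (Fin 3) → EuclideanSpace ℝ (Fin 3)) (p : ℝ → EuclideanSpace ℝ (Fin 3) → ℝ)
        (H : ℝ → EuclideanSpace ℝ (Fin 3) → EuclideanSpace ℝ (Fin 3) →L[ℝ] EuclideanSpace ℝ (Fin 3)) (c : ℝ≥0)
        (V : EuclideanSpace ℝ (Fin 3) → EuclideanSpace ℝ (Fin 3)) (P : EuclideanSpace ℝ (Fin 3) → ℝ),
        Birth.InClass ρ u p H c → Birth.IsExactlySelfSimilar ρ u p V P →
          (∃ G : EuclideanSpace ℝ (Fin 3) → EuclideanSpace ℝ (Fin 3) →L[ℝ] EuclideanSpace ℝ (Fin 3),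
            HasWeakGradient V G ∧
              IntegrableOn (fun y => ‖G y‖ ^ 2) (closedBall (0 : EuclideanSpace ℝ (Fin 3)) 1) volume ∧
              ∀ ψ : EuclideanSpace ℝ (Fin 3) → ℝ, ContDiff ℝ ∞ ψ → HasCompactSupport ψ → ∀ v w : EuclideanSpace ℝ (Fin 3),
                ∫ y, ⟪V y, fderiv ℝ (fun z : EuclideanSpace ℝ (Fin 3) => fderiv ℝ ψ z v • w - fderiv ℝ ψ z w • v) y (V y)⟫ = 0) →
          uncurry u =ᵐ[volume.restrict (Iio (0 : ℝ) ×ˢ (univ : Set (EuclideanSpace ℝ (Fin 3))))] 0 := by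
  intro ρ hρ hρh u p H c V P hcl hss hW
  obtain ⟨hsw, hH, hgauge⟩ := hcl
  obtain ⟨G, hG, hG2, hLamb⟩ := hW
  have hρ1 : ρ < 1 := by linarith
  -- `V ∈ L¹_loc`, `|V|² ∈ L¹_loc` from the `A`-gauge
  have hVli : LocallyIntegrable V volume := locallyIntegrableOn_univ.1 (by
    simpa only [Opens.coe_top] using hG.locallyIntegrableOn)
  have hA : ∀ a : ℝ, 0 < a → ENNReal.ofReal (a ^ (2 * ρ)) *
      cknA a (0 : ℝ × EuclideanSpace ℝ (Fin 3)) u ≤ (c : ℝ≥0∞) :=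
    fun a ha => le_trans (le_trans le_self_add le_self_add) (hgauge a ha)
  have hV2 : LocallyIntegrable (fun y => ‖V y‖ ^ 2) volume :=
    EnergySaturation.locallyIntegrable_norm_sq_of_growth hVli.aestronglyMeasurable (profile_energy_growth_of_gaugeA hρ hss.1 hA)
  -- `P ∈ L¹_loc` from the `D`-gauge
  have hD : ∀ a : ℝ, 0 < a → ENNReal.ofReal (a ^ (2 * ρ)) *
      cknD a (0 : ℝ × EuclideanSpace ℝ (Fin 3)) p ≤ (c : ℝ≥0∞) :=
    fun a ha => le_trans le_add_self (hgauge a ha)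
  have hpm : AEStronglyMeasurable (uncurry p)
      (volume.restrict (Iio (0 : ℝ) ×ˢ (univ : Set (EuclideanSpace ℝ (Fin 3))))) := by
    have := hsw.distributional.2.2.1.aestronglyMeasurable
    simpa [slab] using this
  have hPm := aestronglyMeasurable_pressureProfile hpm hss.2
  have hDprof := profile_pressure_weight_of_gaugeD hρ hρ1 hpm hss.2 hD
  have hP1 : LocallyIntegrable P volume :=
    EnergySaturation.locallyIntegrable_pressure_of_weight hρ1 hPm
      (ENNReal.mul_ne_top ENNReal.ofReal_ne_top ENNReal.coe_ne_top) hDprof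
  -- the curl-tested identity, then the weak-class member theorem
  have hCT := WeakLamb.curlTested_of_lambFree hsw.distributional hss.1 hss.2 hVli hV2 hP1 hLamb
  exact Loc.selfSimilar_ae_eq_zero_of_weaklyCommuting_profile hρ hsw hH hgauge hss.1 hG hG2 hCT

/-! ### Intrinsic forms (appended by hand leafhand-ns-eulerzoomliouville-10 g2): the weak gradient is supplied by the class

The by-name theorems `Birth.selfSimilarWeak_of_weaklyCommuting` (`…WeakCommutingMember`) and `Birth.selfSimilarWeak_of_lambFree` (above) ask for a
whole-space weak gradient `G` of the profile with `‖G‖² ∈ L¹(B̄₁)`.  Inside the class this is automatic: the `E`-gauge gives the exactly self-similar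
member a profile gradient `G ∈ L²_loc` with `HasWeakFDerivOn ⊤ volume V G` (`Past.profileData_of_past`, `0 < ρ ≤ ½`).  So the binders are over `V`
ALONE — the shape a skeleton binder must have. -/

/-- The class's profile gradient: for a class member exactly self-similar about the origin (`0 < ρ ≤ ½`) the velocity profile has a whole-space
weak gradient `G` with `‖G‖²` integrable on the closed unit ball (`Past.profileData_of_past`: `G ∈ L²(B_r)` for every `r`). [folklore] -/
theorem Birth.exists_hasWeakGradient_profile {ρ : ℝ} (hρ : 0 < ρ) (hρh : ρ ≤ 1 / 2)
    {u : ℝ → EuclideanSpace ℝ (Fin 3) → EuclideanSpace ℝ (Fin 3)} {p : ℝ → EuclideanSpace ℝ (Fin 3) → ℝ}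
    {H : ℝ → EuclideanSpace ℝ (Fin 3) → EuclideanSpace ℝ (Fin 3) →L[ℝ] EuclideanSpace ℝ (Fin 3)} {c : ℝ≥0}
    {V : EuclideanSpace ℝ (Fin 3) → EuclideanSpace ℝ (Fin 3)} {P : EuclideanSpace ℝ (Fin 3) → ℝ}
    (hcl : Birth.InClass ρ u p H c) (hss : Birth.IsExactlySelfSimilar ρ u p V P) :
    ∃ G : EuclideanSpace ℝ (Fin 3) → EuclideanSpace ℝ (Fin 3) →L[ℝ] EuclideanSpace ℝ (Fin 3),
      HasWeakGradient V G ∧ IntegrableOn (fun y => ‖G y‖ ^ 2) (closedBall (0 : EuclideanSpace ℝ (Fin 3)) 1) volume := by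
  obtain ⟨hsw, hH, hgauge⟩ := hcl
  have hA : ∀ a : ℝ, 0 < a → ENNReal.ofReal (a ^ (2 * ρ)) *
      cknA a (0 : ℝ × EuclideanSpace ℝ (Fin 3)) u ≤ (c : ℝ≥0∞) :=
    fun a ha => le_trans (le_trans le_self_add le_self_add) (hgauge a ha)
  have hE : ∀ a : ℝ, 0 < a → ENNReal.ofReal (a ^ ρ) *
      cknE a (0 : ℝ × EuclideanSpace ℝ (Fin 3)) H ≤ (c : ℝ≥0∞) :=
    fun a ha => le_trans (le_trans le_add_self le_self_add) (hgauge a ha)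
  have hD : ∀ a : ℝ, 0 < a → ENNReal.ofReal (a ^ (2 * ρ)) *
      cknD a (0 : ℝ × EuclideanSpace ℝ (Fin 3)) p ≤ (c : ℝ≥0∞) :=
    fun a ha => le_trans le_add_self (hgauge a ha)
  have hu' : ∀ τ : ℝ, τ < 0 → u τ = fun x => selfSimilarCollapse (1 / (2 + ρ)) 0 V τ (x - 0) :=
    fun τ hτ => by rw [hss.1 τ hτ]; funext x; rw [sub_zero]
  have hp' : ∀ τ : ℝ, τ < 0 → p τ = fun x => selfSimilarCollapsePressure (1 / (2 + ρ)) 0 P τ (x - 0) :=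
    fun τ hτ => by rw [hss.2 τ hτ]; funext x; rw [sub_zero]
  obtain ⟨G, -, -, -, hVG, -, -, -, -, -, hG2, -⟩ :=
    Past.profileData_of_past hρ hρh le_rfl le_rfl 0 hsw.distributional hH hA hE hD hu' hp'
  refine ⟨G, hVG, ?_⟩
  have h2 : Integrable (fun y => ‖G y‖ ^ 2) (volume.restrict (ball (0 : EuclideanSpace ℝ (Fin 3)) 2)) :=
    (memLp_two_iff_integrable_sq_norm (hG2 2).1).1 (hG2 2)
  exact IntegrableOn.mono_set h2 (closedBall_subset_ball (by norm_num))

/-- **INTRINSIC FORM of `Birth.selfSimilarWeak_of_weaklyCommuting`** (hypothesis on `V` alone, every `0 < ρ ≤ ½`, no `C²`): a class member exactly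
self-similar about the origin whose velocity profile satisfies the CURL-TESTED WEAK PROFILE IDENTITY WITHOUT LAMB TERM,
`γ ∫⟪V, Dη_ψ[y]⟫ + (4γ−1) ∫⟪V, η_ψ⟫ = 0` for all curl pairs `η_ψ = (∂ᵥψ)w − (∂_wψ)v`, is trivial. [folklore] -/
theorem Birth.selfSimilarWeak_of_weaklyCommuting_intrinsic :
    ∀ ρ : ℝ, 0 < ρ → ρ ≤ 1 / 2 →
      ∀ (u : ℝ → EuclideanSpace ℝ (Fin 3) → EuclideanSpace ℝ (Fin 3)) (p : ℝ → EuclideanSpace ℝ (Fin 3) → ℝ)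
        (H : ℝ → EuclideanSpace ℝ (Fin 3) → EuclideanSpace ℝ (Fin 3) →L[ℝ] EuclideanSpace ℝ (Fin 3)) (c : ℝ≥0)
        (V : EuclideanSpace ℝ (Fin 3) → EuclideanSpace ℝ (Fin 3)) (P : EuclideanSpace ℝ (Fin 3) → ℝ),
        Birth.InClass ρ u p H c → Birth.IsExactlySelfSimilar ρ u p V P →
          (∀ ψ : EuclideanSpace ℝ (Fin 3) → ℝ, ContDiff ℝ ∞ ψ → HasCompactSupport ψ → ∀ v w : EuclideanSpace ℝ (Fin 3),
            (1 / (2 + ρ)) *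
                (∫ y, ⟪V y, fderiv ℝ (fun z : EuclideanSpace ℝ (Fin 3) => fderiv ℝ ψ z v • w - fderiv ℝ ψ z w • v) y y⟫) +
              (4 * (1 / (2 + ρ)) - 1) * (∫ y, ⟪V y, fderiv ℝ ψ y v • w - fderiv ℝ ψ y w • v⟫) = 0) →
          uncurry u =ᵐ[volume.restrict (Iio (0 : ℝ) ×ˢ (univ : Set (EuclideanSpace ℝ (Fin 3))))] 0 := by
  intro ρ hρ hρh u p H c V P hcl hss hCT
  obtain ⟨G, hG, hG2⟩ := Birth.exists_hasWeakGradient_profile hρ hρh hcl hss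
  exact Birth.selfSimilarWeak_of_weaklyCommuting ρ hρ u p H c V P hcl hss ⟨G, hG, hG2, hCT⟩

/-- **INTRINSIC FORM of `Birth.selfSimilarWeak_of_lambFree`** (hypothesis on `V` alone, every `0 < ρ ≤ ½`, no `C²`): a class member exactly
self-similar about the origin whose velocity-tested weak Lamb curl vanishes on all curl pairs, `∫⟪V, Dη_ψ[V]⟫ = 0` (weak generalized Beltrami /
weakly commuting velocity and vorticity), is trivial. [folklore] -/
theorem Birth.selfSimilarWeak_of_lambFree_intrinsic :
    ∀ ρ : ℝ, 0 < ρ → ρ ≤ 1 / 2 →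
      ∀ (u : ℝ → EuclideanSpace ℝ (Fin 3) → EuclideanSpace ℝ (Fin 3)) (p : ℝ → EuclideanSpace ℝ (Fin 3) → ℝ)
        (H : ℝ → EuclideanSpace ℝ (Fin 3) → EuclideanSpace ℝ (Fin 3) →L[ℝ] EuclideanSpace ℝ (Fin 3)) (c : ℝ≥0)
        (V : EuclideanSpace ℝ (Fin 3) → EuclideanSpace ℝ (Fin 3)) (P : EuclideanSpace ℝ (Fin 3) → ℝ),
        Birth.InClass ρ u p H c → Birth.IsExactlySelfSimilar ρ u p V P →
          (∀ ψ : EuclideanSpace ℝ (Fin 3) → ℝ, ContDiff ℝ ∞ ψ → HasCompactSupport ψ → ∀ v w : EuclideanSpace ℝ (Fin 3),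
            ∫ y, ⟪V y, fderiv ℝ (fun z : EuclideanSpace ℝ (Fin 3) => fderiv ℝ ψ z v • w - fderiv ℝ ψ z w • v) y (V y)⟫ = 0) →
          uncurry u =ᵐ[volume.restrict (Iio (0 : ℝ) ×ˢ (univ : Set (EuclideanSpace ℝ (Fin 3))))] 0 := by
  intro ρ hρ hρh u p H c V P hcl hss hLamb
  obtain ⟨G, hG, hG2⟩ := Birth.exists_hasWeakGradient_profile hρ hρh hcl hss
  exact Birth.selfSimilarWeak_of_lambFree ρ hρ hρh u p H c V P hcl hss ⟨G, hG, hG2, hLamb⟩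

end Summit.NavierStokesRegularity.NavierStokesRegularity.Theorems.PowerGaugeEulerLiouville

end
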